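import Mathlib.Analysis.PSeries
import Summits.QuantumFields.BalabanUV.T4Continuum.Support.UrsellTermBudget
import Summits.QuantumFields.BalabanUV.T4Continuum.Support.B13DomainGeometryTR

/-!
# NE5 ∕ U3 — the SMALLNESS in the [26]-convergence binder of row O1-d3 is NECESSARY: on leaf-02's socket the combinatorial
# majorant of the ordered series (2.13) is NOT summable at any step-`k` domain `X` with `actSum(X) ≥ 1`
# (the Ursell coefficient of the constant tuple `(X,…,X)` is `(−1)ⁿ·n!`); on Bałaban's carriers OF RECORD a (2.38)-SHAPED
# majorant saturated at the single cubes with `ε ≥ 1` diverges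

Cell `pub-balaban`, unit `b2b-balaban-t4-ne5-formalise-leaf-02` (NE5 formalisation swarm, LEAF PROVER 02, gen 3; row O1-d1 holder —
`Support/B13StepTermLabels` p207773, `Support/B13StepTermSocket` p208148, `Support/B13InnerData` p208616; journal INTENT l.7698).
Summits-side NEW WORK under the LEAN PLACEMENT RULE (a kernel NEGATIVE CONTROL on the cell's own bookkeeping objects; NOT a
Literature module; nothing of [Balaban1988RG2Cluster] asserted).  HONEST FRAMING: rung (B)+1 of the FINITE-VOLUME T⁴ continuum
programme — NOT infinite volume, NOT a mass gap, NOT the Clay problem, NOT a proof of NE5.  HONEST DEPENDENCY (cell line, verbatim):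
continuum YM on T⁴ ⇐ BetaPertH ∧ nine spine estimates (0/9 proved); BetaPertH ⇐ (D1) ∧ (D4) ∧ CAP+tail; G-an2-4 gates asym, D1 and
NE2/3/4.

WHAT.  Leaf-08's parts 3 ∕ 5 ∕ 6 (`UrsellTermBudget.summable_actMajorant` p209547, `UrsellActivityNorm` p210250, `UrsellOfRecord`
p210518) and leaf-02's `UrsellOfRecordFaces` (p210977) give the SUFFICIENT condition for the convergence binder of row O1-d3 on the
socket `labelsIndexing G D` ∕ `touchInc G`: an activity majorant with anchored exponential norm `Φ`, `4νΦ < 1` — on Bałaban's carriers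
of record «the (2.38) SHAPE `actSum ≤ ε·e^{−R d}` + rate room + `36·ε·e^{64}·K₀(64,8) < 1`».  THIS FILE proves that SOME smallness is
NECESSARY — the binder is load-bearing, not an artefact of the majorisation:
* §1 (generic combinatorics over the tree's Möbius-defined `Literature.Probability.LatticeModels.hcUrsell`): the CYCLE-COUNT identity
  `Σ_{ρ ∈ setPartitions W} Π_{Q ∈ ρ} (#Q − 1)! = (#W)!` (`sum_setPartitions_prod_factorial_pred`) and **`hcUrsell_complete`**: for a
  hard core `H` with `u ≠ w → H u w`, `hcUrsell H V = (−1)ⁿ·n!` when `#V = n + 1` (rooted recursion `hcUrsell_eq_hcRootedUrsell`,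
  Friedli–Velenik (5.13)–(5.14), BY NAME) — a candidate for up-streaming next to `hcUrsell_pair`;
* §2 (ANY `DomainGeometry G`, `InnerData D`, nonnegative per-label majorant `𝒜`, step-`k` domain `X`): the CONSTANT tuple `(X,…,X)`
  is in leaf-02's catalogue `polyTuples G k X n` for every `n` (`const_mem_polyTuples`), its Ursell coefficient is `(−1)ⁿ·n!`
  (`rhoT_const`), hence the LEVEL LOWER BOUND `actSum(X)^{n+1}∕(n+1) ≤ Σ_{t ∈ termLabels G D k X n} actMajorant … ⟨n, t⟩`
  (`pow_div_le_level`, through leaf-08's `level_eq`) and **`not_summable_actMajorant_of_one_le`**: `1 ≤ actSum D 𝒜 k X` ⟹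
  `¬ Summable (actMajorant (labelsIndexing G D) (touchInc G) 𝒜 k X)` (harmonic series); contrapositive `actSum_lt_one_of_summable`;
* §3 (Bałaban's carriers OF RECORD `R : B13Carriers.TwoRuns G`, geometry of record `B13DomainGeometryTR.domainGeometry R`): at the
  single-cube domains `R.mkDom j (singleDom a) ∈ 𝐃_j` (tree length `0`, `B13Carriers.TwoRuns.d_singleDom`) a (2.38)-SHAPED majorant
  SATURATED FROM BELOW, `ε·e^{−Rt·d} ≤ actSum`, with `ε ≥ 1` is not summable (**`not_summable_b13_of_saturated`**) — facing the
  sufficient `36·ε·e^{64}·K₀ < 1` of `UrsellOfRecord` ∕ `UrsellOfRecordFaces`.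
No definitions; 0 sorry; axioms ⊆ {propext, Classical.choice, Quot.sound}.
-/

noncomputable section

open Finset Filter
open scoped BigOperators

namespace Summit.QuantumFields.BalabanUV.T4Continuum.UrsellSmallnessNecessity

open Literature.Probability.LatticeModels

/-! ## §1 The Ursell coefficient of the complete hard core -/

section Complete

variable {α : Type*} [DecidableEq α]

/-- [folklore] **THE CYCLE-COUNT IDENTITY** `Σ_{ρ ∈ setPartitions W} Π_{Q ∈ ρ} (#Q − 1)! = (#W)!` (a permutation of `W` is a set
partition into its cycles with a cyclic order on each block; proved here by the block decomposition at a fixed element and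
Vandermonde-free counting: `Σ_b C(m, b)·b!·(m − b)! = (m + 1)·m!`). -/
theorem sum_setPartitions_prod_factorial_pred :
    ∀ (n : ℕ) (W : Finset α), W.card = n → ∑ ρ ∈ setPartitions W, ∏ Q ∈ ρ, (Q.card - 1).factorial = n.factorial := by
  intro n
  induction n using Nat.strong_induction_on with
  | _ n ih =>
  intro W hW
  rcases W.eq_empty_or_nonempty with rfl | ⟨v, hv⟩
  · rw [Finset.card_empty] at hW
    subst hW
    rw [setPartitions_empty, sum_singleton, prod_empty, Nat.factorial_zero]
  · have hstep : ∀ P₀ ∈ W.powerset.filter (fun P => v ∈ P),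
        ∑ κ ∈ setPartitions (W \ P₀), ∏ Q ∈ insert P₀ κ, (Q.card - 1).factorial =
          (P₀.card - 1).factorial * (W.card - P₀.card).factorial := by
      intro P₀ hP₀
      obtain ⟨hPW, hvP⟩ := mem_filter.1 hP₀
      have hPW' : P₀ ⊆ W := mem_powerset.1 hPW
      have hcard : (W \ P₀).card = W.card - P₀.card := card_sdiff_of_subset hPW'
      have hlt : (W \ P₀).card < n := by
        have h1 : 0 < P₀.card := card_pos.2 ⟨v, hvP⟩
        have h2 : P₀.card ≤ W.card := card_le_card hPW'
        omega
      calc ∑ κ ∈ setPartitions (W \ P₀), ∏ Q ∈ insert P₀ κ, (Q.card - 1).factorial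
          = ∑ κ ∈ setPartitions (W \ P₀), (P₀.card - 1).factorial * ∏ Q ∈ κ, (Q.card - 1).factorial :=
            sum_congr rfl fun κ hκ => by rw [prod_insert ((mem_setPartitions.1 hκ).notMem_of_sdiff ⟨v, hvP⟩)]
        _ = (P₀.card - 1).factorial * (W.card - P₀.card).factorial := by
            rw [← mul_sum, ih _ hlt (W \ P₀) rfl, hcard]
    rw [sum_setPartitions_eq_sum_block hv, sum_congr rfl hstep, sum_filter_mem_eq_sum_powerset_erase W hv]
    have hWe : W.card = (W.erase v).card + 1 := (card_erase_add_one hv).symm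
    calc ∑ Q' ∈ (W.erase v).powerset, ((insert v Q').card - 1).factorial * (W.card - (insert v Q').card).factorial
        = ∑ Q' ∈ (W.erase v).powerset, (Q'.card.factorial * ((W.erase v).card - Q'.card).factorial) := by
          refine sum_congr rfl fun Q' hQ' => ?_
          have hvQ' : v ∉ Q' := fun h => (mem_erase.1 (mem_powerset.1 hQ' h)).1 rfl
          rw [card_insert_of_notMem hvQ', hWe, Nat.add_sub_cancel, Nat.add_sub_add_right]
      _ = ∑ b ∈ range ((W.erase v).card + 1),
            ((W.erase v).card.choose b) • (b.factorial * ((W.erase v).card - b).factorial) :=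
          Finset.sum_powerset_apply_card (fun b => b.factorial * ((W.erase v).card - b).factorial)
      _ = ∑ _b ∈ range ((W.erase v).card + 1), (W.erase v).card.factorial := by
          refine sum_congr rfl fun b hb => ?_
          rw [smul_eq_mul, ← mul_assoc, Nat.choose_mul_factorial_mul_factorial (Nat.lt_succ_iff.1 (mem_range.1 hb))]
      _ = n.factorial := by rw [sum_const, card_range, smul_eq_mul, ← Nat.factorial_succ, ← hWe, hW]

/-- [folklore] **THE URSELL COEFFICIENT OF THE COMPLETE HARD CORE**: if every two distinct vertices are incompatible, then
`hcUrsell H V = (−1)ⁿ · n!` for `#V = n + 1` (the alternating sum over the connected graphs on `n + 1` labelled vertices;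
here from the rooted recursion `hcUrsell_eq_hcRootedUrsell` — every block is adjacent to the root — and the cycle-count identity). -/
theorem hcUrsell_complete (H : α → α → Prop) [DecidableRel H] (hH : ∀ u w, u ≠ w → H u w) :
    ∀ (n : ℕ) (V : Finset α), V.card = n + 1 → hcUrsell H V = (-1) ^ n * (n.factorial : ℤ) := by
  have hsymm : ∀ a b, H a b → H b a := by
    intro a b hab
    by_cases h : b = a
    · subst h; exact hab
    · exact hH b a h
  intro n
  induction n using Nat.strong_induction_on with
  | _ n ih =>
  intro V hV
  obtain ⟨v, hv⟩ : V.Nonempty := card_pos.1 (by omega)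
  have hVe : (V.erase v).card = n := by rw [card_erase_of_mem hv, hV]; omega
  rw [hcUrsell_eq_hcRootedUrsell hsymm hv, hcRootedUrsell]
  have hρ : ∀ ρ ∈ setPartitions (V.erase v),
      (-1 : ℤ) ^ ρ.card * ∏ Q ∈ ρ, (adjInd H v Q * hcUrsell H Q) = (-1) ^ n * ∏ Q ∈ ρ, ((Q.card - 1).factorial : ℤ) := by
    intro ρ hρ
    have hπ := mem_setPartitions.1 hρ
    have hQ : ∀ Q ∈ ρ, adjInd H v Q * hcUrsell H Q = (-1) ^ (Q.card - 1) * ((Q.card - 1).factorial : ℤ) := by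
      intro Q hQ
      obtain ⟨u, hu⟩ := hπ.nonempty_of_mem hQ
      have huV : u ∈ V.erase v := hπ.subset hQ hu
      have hadj : adjInd H v Q = 1 := if_pos ⟨u, hu, hH v u (mem_erase.1 huV).1.symm⟩
      have hQcard : Q.card - 1 < n := by
        have h1 : Q.card ≤ (V.erase v).card := card_le_card (hπ.subset hQ)
        have h2 : 0 < Q.card := card_pos.2 ⟨u, hu⟩
        omega
      rw [hadj, one_mul, ih _ hQcard Q (Nat.sub_add_cancel (card_pos.2 ⟨u, hu⟩)).symm]
    have hsum : ∑ Q ∈ ρ, Q.card = n := hπ.sum_card.trans hVe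
    have hsub : ∑ Q ∈ ρ, (Q.card - 1) + ρ.card = ∑ Q ∈ ρ, Q.card := by
      rw [card_eq_sum_ones ρ, ← sum_add_distrib]
      exact sum_congr rfl fun Q hQ => Nat.sub_add_cancel (card_pos.2 (hπ.nonempty_of_mem hQ))
    rw [prod_congr rfl hQ, prod_mul_distrib, ← mul_assoc, prod_pow_eq_pow_sum, ← pow_add]
    congr 2
    omega
  rw [sum_congr rfl hρ, ← mul_sum]
  congr 1
  exact_mod_cast sum_setPartitions_prod_factorial_pred n (V.erase v) hVe

end Complete

/-! ## §2 The generic socket: the constant tuple and the divergence of the majorant series at `actSum(X) ≥ 1` -/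

section Socket

open Literature.MathematicalPhysics.QuantumFieldTheory.Balaban1983to89.T4OutputRate (Carriers)
open Summit.QuantumFields.BalabanUV.T4Continuum.ClusterRepOfDomains (DomainGeometry)
open Summit.QuantumFields.BalabanUV.T4Continuum.B13StepTermLabels
open Summit.QuantumFields.BalabanUV.T4Continuum.B13StepTermSocket (labelsIndexing touchInc)
open Summit.QuantumFields.BalabanUV.T4Continuum.B13TermRep (actMajorant actMajorant_nonneg)
open Summit.QuantumFields.BalabanUV.T4Continuum.UrsellTermBudget (actSum actSum_nonneg level_eq actMajorant_eq_zero_of_not_mem)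

variable {C : Carriers} [DecidableEq C.Dom] {Cube : Type*} [DecidableEq Cube] {Bnd : Type*} [DecidableEq Bnd]
  (G : DomainGeometry C Cube) (D : InnerData C Bnd) (𝒜 : C.Dom → InnerLabel C.Dom Bnd → ℝ)

omit [DecidableEq Bnd] in
/-- [folklore] THE CONSTANT TUPLE `(X, …, X)` with `n + 1` entries is in leaf-02's tuple catalogue `polyTuples G k X n` at every
step-`k` domain `X` (each member is a step-`k` domain inside `X`, and the footprints cover `X`). -/
theorem const_mem_polyTuples {k : ℕ} {X : C.Dom} (hX : C.scale X = k) (n : ℕ) :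
    (fun _ : Fin (n + 1) => X) ∈ polyTuples G k X n := by
  refine (mem_polyTuples G).2 ⟨fun _ => ⟨(G.mem_level X k).2 hX, subset_rfl⟩, ?_⟩
  show (Finset.univ.biUnion fun _ : Fin (n + 1) => G.cubes X) = G.cubes X
  ext q
  constructor
  · intro h
    obtain ⟨_, _, h⟩ := mem_biUnion.1 h
    exact h
  · intro h
    exact mem_biUnion.2 ⟨0, mem_univ _, h⟩

omit [DecidableEq Bnd] in
/-- [folklore] **`ρᵀ(X, …, X) = (−1)ⁿ·n!`**: the members of the constant tuple pairwise touch (their footprints coincide and are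
nonempty, `touch_of_inter`), so its Ursell coefficient is that of the complete hard core on `n + 1` indices (§1). -/
theorem rhoT_const (X : C.Dom) (n : ℕ) :
    B13StepTermFamily.rhoT (touchInc G) (fun _ : Fin (n + 1) => X) = (-1) ^ n * (n.factorial : ℤ) := by
  unfold B13StepTermFamily.rhoT
  refine hcUrsell_complete _ (fun _ _ _ => ?_) n Finset.univ (by rw [Finset.card_univ, Fintype.card_fin])
  exact G.touch_of_inter _ _ (by rw [Finset.inter_self]; exact G.cubes_nonempty X)

omit [DecidableEq Bnd] in
/-- [folklore] The modulus of the constant tuple's coefficient, as a real number: `|ρᵀ(X,…,X)| = n!`. -/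
theorem abs_rhoT_const (X : C.Dom) (n : ℕ) :
    |((B13StepTermFamily.rhoT (touchInc G) (fun _ : Fin (n + 1) => X) : ℤ) : ℝ)| = (n.factorial : ℝ) := by
  rw [rhoT_const G X n]
  push_cast
  rw [abs_mul, abs_pow, abs_neg, abs_one, one_pow, one_mul, abs_of_nonneg (Nat.cast_nonneg _)]

/-- **THE LEVEL LOWER BOUND**: at a step-`k` domain `X`, the level-`n` sum of leaf-04's `actMajorant` over leaf-02's catalogue
`termLabels G D k X n` is at least the constant tuple's share `n!∕(n+1)! · actSum(X)^{n+1} = actSum(X)^{n+1}∕(n+1)` (all other tuples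
contribute nonnegatively; leaf-08's `level_eq` BY NAME). -/
theorem pow_div_le_level (h𝒜 : ∀ Z ℓ, 0 ≤ 𝒜 Z ℓ) {k : ℕ} {X : C.Dom} (hX : C.scale X = k) (n : ℕ) :
    actSum D 𝒜 k X ^ (n + 1) / (n + 1) ≤
      ∑ t ∈ termLabels G D k X n, actMajorant (labelsIndexing G D) (touchInc G) 𝒜 k X ⟨n, t⟩ := by
  rw [level_eq G D 𝒜 hX n]
  have hfac : (0 : ℝ) < n.factorial := by exact_mod_cast Nat.factorial_pos n
  have hval : |((B13StepTermFamily.rhoT (touchInc G) (fun _ : Fin (n + 1) => X) : ℤ) : ℝ)| / ((n + 1).factorial : ℝ) *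
      ∏ _m : Fin (n + 1), actSum D 𝒜 k X = actSum D 𝒜 k X ^ (n + 1) / (n + 1) := by
    rw [abs_rhoT_const G X n, Fin.prod_const, Nat.factorial_succ, Nat.cast_mul, Nat.cast_succ,
      mul_comm ((n : ℝ) + 1) _, ← div_div, div_self hfac.ne', div_eq_inv_mul (actSum D 𝒜 k X ^ (n + 1)), one_div]
  rw [← hval]
  exact single_le_sum (s := polyTuples G k X n)
    (f := fun Z => |((B13StepTermFamily.rhoT (touchInc G) Z : ℤ) : ℝ)| / ((n + 1).factorial : ℝ) * ∏ m, actSum D 𝒜 k (Z m))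
    (fun Z _ => mul_nonneg (div_nonneg (abs_nonneg _) (Nat.cast_nonneg _)) (prod_nonneg fun _ _ => actSum_nonneg D 𝒜 h𝒜 k _))
    (const_mem_polyTuples G hX n)

/-- [folklore] The level-`n` part of the majorant series is a finite sum over leaf-02's catalogue (zero off `termLabels`). -/
theorem tsum_level_eq (k : ℕ) (X : C.Dom) (n : ℕ) :
    ∑' t : Fin (n + 1) → PolyLabel C.Dom Bnd, actMajorant (labelsIndexing G D) (touchInc G) 𝒜 k X ⟨n, t⟩ =
      ∑ t ∈ termLabels G D k X n, actMajorant (labelsIndexing G D) (touchInc G) 𝒜 k X ⟨n, t⟩ :=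
  tsum_eq_sum (s := termLabels G D k X n) fun _ ht => actMajorant_eq_zero_of_not_mem G D 𝒜 ht

/-- **NECESSITY OF SMALLNESS FOR THE [26]-CONVERGENCE ON THE SOCKET.**  For ANY domain geometry, inner data and nonnegative
per-label majorant `𝒜`: at a step-`k` domain `X` whose activity majorant `actSum D 𝒜 k X = Σ_{ℓ ∈ innerLabels D k X} 𝒜 X ℓ` is `≥ 1`,
the combinatorial majorant of the ordered series (2.13) is NOT summable — the levels are bounded below by the harmonic series.  So the
displayed convergence binder (`Summable (actMajorant …)`, leaf-04's `hconv`; leaf-08's anchored norm `Φ` with `4νΦ < 1`; on the carriers of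
record «(2.38) SHAPE + two numbers») is load-bearing: no majorisation of this kind converges without a smallness condition. -/
theorem not_summable_actMajorant_of_one_le (h𝒜 : ∀ Z ℓ, 0 ≤ 𝒜 Z ℓ) {k : ℕ} {X : C.Dom} (hX : C.scale X = k)
    (ha : 1 ≤ actSum D 𝒜 k X) : ¬ Summable (actMajorant (labelsIndexing G D) (touchInc G) 𝒜 k X) := by
  intro hsum
  have h0 : ∀ i, 0 ≤ actMajorant (labelsIndexing G D) (touchInc G) 𝒜 k X i := actMajorant_nonneg h𝒜 k X
  obtain ⟨-, houter⟩ := (summable_sigma_of_nonneg h0).1 hsum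
  have hharm : Summable fun n : ℕ => (1 : ℝ) / ((n : ℝ) + 1) := by
    refine Summable.of_nonneg_of_le (fun n => by positivity) (fun n => ?_) houter
    rw [tsum_level_eq G D 𝒜 k X n]
    refine le_trans ?_ (pow_div_le_level G D 𝒜 h𝒜 hX n)
    exact div_le_div_of_nonneg_right (one_le_pow₀ ha) (by positivity)
  exact (not_summable_iff_tendsto_nat_atTop_of_nonneg (fun n => by positivity)).2
    Real.tendsto_sum_range_one_div_nat_succ_atTop hharm

/-- **THE NECESSARY CONDITION, contrapositive form**: if the combinatorial majorant is summable at a step-`k` domain `X`, then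
`actSum D 𝒜 k X < 1`. -/
theorem actSum_lt_one_of_summable (h𝒜 : ∀ Z ℓ, 0 ≤ 𝒜 Z ℓ) {k : ℕ} {X : C.Dom} (hX : C.scale X = k)
    (hsum : Summable (actMajorant (labelsIndexing G D) (touchInc G) 𝒜 k X)) : actSum D 𝒜 k X < 1 :=
  lt_of_not_ge fun ha => not_summable_actMajorant_of_one_le G D 𝒜 h𝒜 hX ha hsum

end Socket

/-! ## §3 On Bałaban's carriers of record: a (2.38)-shaped majorant saturated at the single cubes with `ε ≥ 1` diverges -/

section Record

open Literature.MathematicalPhysics.QuantumFieldTheory.Balaban1983to89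
open Literature.MathematicalPhysics.QuantumFieldTheory.Balaban1983to89.TreeLengthTorus (TPt)
open Summit.QuantumFields.BalabanUV.T4Continuum.B13StepTermLabels (InnerLabel InnerData)
open Summit.QuantumFields.BalabanUV.T4Continuum.B13StepTermSocket (labelsIndexing touchInc)
open Summit.QuantumFields.BalabanUV.T4Continuum.B13TermRep (actMajorant)
open Summit.QuantumFields.BalabanUV.T4Continuum.UrsellTermBudget (actSum)
open Summit.QuantumFields.BalabanUV.T4Continuum.B13Carriers (TwoRuns singleDom)
open Summit.QuantumFields.BalabanUV.T4Continuum.B13DomainGeometryTR (domainGeometry)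

variable {𝔊 : Type} [GaugeGroup 𝔊] (R : TwoRuns 𝔊) {Bd : Type*} [DecidableEq Bd] (D : InnerData R.carriers Bd)

/-- **NECESSITY ON THE CARRIERS OF RECORD.**  For ANY inner data `D` on Bałaban's paired-torus carriers and any nonnegative
per-label majorant `𝒜` whose polymer sums are bounded BELOW by a (2.38)-shaped profile `ε·e^{−Rt·d(Z)}` at the single-cube domain
`X₀ = R.mkDom j (singleDom a)` of step `j` (tree length `d(X₀) = 0`), with `ε ≥ 1`: the combinatorial majorant on the socket of record
`labelsIndexing (domainGeometry R) D` ∕ `touchInc (domainGeometry R)` is NOT summable at `X₀`.  The sufficient side is leaf-08's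
`UrsellOfRecord` ∕ leaf-02's `UrsellOfRecordFaces.summable_actMajorant_b13` (`actSum ≤ ε·e^{−Rt·d}`, `64·log 162 + 64 ≤ Rt`,
`36·ε·e^{64}·K₀(64,8) < 1`): between them, the smallness letter is load-bearing. -/
theorem not_summable_b13_of_saturated (𝒜 : R.carriers.Dom → InnerLabel R.carriers.Dom Bd → ℝ) (h𝒜 : ∀ Z ℓ, 0 ≤ 𝒜 Z ℓ)
    {ε Rt : ℝ} (hε : 1 ≤ ε) (j : ℕ) (a : TPt 4 (R.cubesPerDir j))
    (hlow : ε * Real.exp (-(Rt * R.carriers.d (R.mkDom j (singleDom a)))) ≤ actSum D 𝒜 j (R.mkDom j (singleDom a))) :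
    ¬ Summable (actMajorant (labelsIndexing (domainGeometry R) D) (touchInc (domainGeometry R)) 𝒜 j (R.mkDom j (singleDom a))) := by
  rw [R.d_singleDom, mul_zero, neg_zero, Real.exp_zero, mul_one] at hlow
  exact not_summable_actMajorant_of_one_le (domainGeometry R) D 𝒜 h𝒜 (R.mem_domAt.1 (R.mem_domAt.2 rfl)) (hε.trans hlow)

/-- **THE NECESSARY CONDITION ON THE CARRIERS OF RECORD, at every step-`k` domain**: summability of the combinatorial majorant at
`X ∈ 𝐃_k` forces `actSum D 𝒜 k X < 1`. -/
theorem actSum_lt_one_of_summable_b13 (𝒜 : R.carriers.Dom → InnerLabel R.carriers.Dom Bd → ℝ) (h𝒜 : ∀ Z ℓ, 0 ≤ 𝒜 Z ℓ)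
    {k : ℕ} {X : R.carriers.Dom} (hX : X ∈ R.domAt k)
    (hsum : Summable (actMajorant (labelsIndexing (domainGeometry R) D) (touchInc (domainGeometry R)) 𝒜 k X)) :
    actSum D 𝒜 k X < 1 :=
  actSum_lt_one_of_summable (domainGeometry R) D 𝒜 h𝒜 (R.mem_domAt.1 hX) hsum

end Record

end Summit.QuantumFields.BalabanUV.T4Continuum.UrsellSmallnessNecessity

end
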